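import Literature.MathematicalPhysics.QuantumLattice.SectorisedKernelNormRefinementPlateau
import Literature.MathematicalPhysics.QuantumLattice.SectorisedKernelNormRefinementPrescribed
import HarnessLib

/-!
# Re-sectorisation of the Hubbard sector kernels across a plateau pair with PRESCRIBED LEGS (the «tracks» by the number of known sectors)

Topic `MathematicalPhysics/QuantumLattice`; Hubbard layer of `SectorisedKernelNormRefinementPrescribed` (generic: `prescribedLegSum_refine_le_split`),
companion of `SectorisedKernelNormRefinementPlateau` (`hubbardSectorKernelNorm_refine_le(_split)_of_plateau_pair`: ONE leg prescribed — the
anchored norm; `hubbardSectorPinnedSum_refine_le_of_plateau_pair`: ALL legs prescribed — one fine tuple).  Setting (BGM 2006 §2.7–2.8): a thin/fat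
pair `F, F̃` (`F̃F = F`, `Σ_ω F_ω(k) = 0 ⇒ F_ω(k) = 0`), a finer family `F′` supported in the plateau `{Σ_ω F_ω = 1}`, so that
`map E(F′) G = map (E(F′)S(F̃)) (sectorPreimage F G)` (`map_sectorAnalysis_eq_map_comp_sectorPreimage_of_plateau`) and the fine sectorised
kernels are the leg-wise transform of `ε_x^{m+1} ·` the coarse ones by the overlap kernel `T = E(F′)S(F̃)` ((2.71), `kernel_map`,
`kernel_sectorPreimage_eq_sectorisedKernel`), which vanishes unless the sector indices are related by a `child` relation containing the support
overlap and the spin/charge labels agree.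

* **`hubbardSectorPrescribedSum_refine_le_split_of_plateau_pair`** — for a set `E` of legs with prescribed fine labels `τ″|_E`, a position-pinned
  leg `p ∈ E`, per-pair position sums of `‖T‖` (`≤ c₁` fine summed, `≤ c₁r` coarse summed), at most `ρ` coarse labels per fine label, refinement
  counts AT FIXED PRESCRIPTION `#{σ″ ∈ A″ : σ″|_E = τ″|_E, σ″ leg-wise child of σ′} ≤ R₁` off a class `B` of coarse label tuples and `≤ R₂` on it,
  and bounds `N₁`, `N₂` on the coarse prescribed sums `ε_x^m Σ_{σ′|_E = τ′|_E} Σ_{x′_p = y} ‖W_{F,σ′}(x′)‖` over all `σ′` / over `σ′ ∈ B`: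
  `ε_x^m Σ_{σ″ ∈ A″, σ″|_E = τ″|_E} Σ_{x″_p = x} ‖W_{F′,σ″}(x″)‖ ≤ c₁^m · c₁r · ρ^{|E|} · ε_x^m · (ε_x · (R₁ N₁ + R₂ N₂))`.

This is the model-currency re-measurement rule of a bookkeeping that carries the sizes of the kernels by the number of KNOWN external sectors
(BGM 2006 §2.8 (2.88)–(2.90), App. A3 Lemma A3.1; cell gate-hubbard-kl, K3 engine child clause (E1), the LEVELS track (Hμ-L) of the blocked birth-level
tower, E1-TOWER-BLOCKED §10): `E = {p}` and `E = univ` are the two extreme tracks already in the companion file.  Everything is proved; no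
definition, no named fact.

## Sources

G. Benfatto, A. Giuliani, V. Mastropietro, Ann. Henri Poincaré 7 (2006) 809–898 = arXiv:cond-mat/0507686, §2.7 (2.70)–(2.71a), App. A3 Lemma A3.1,
§2.8 (2.82)–(2.84), (2.89)–(2.90) [`BenfattoGiulianiMastropietro2006`].
-/

noncomputable section

namespace Literature.MathematicalPhysics.QuantumLattice

open GrassmannAlgebra Finset Literature.Probability.LatticeModels

variable {L M : ℕ} [NeZero L] [NeZero M] {N N' : ℕ}

omit [NeZero L] [NeZero M] in
/-- Splitting a sum over tuples of (position, label) pairs into the label tuples and the position tuples. [folklore] -/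
private theorem sum_tuple_prod_eq_sum_sum' {α : Type*} [AddCommMonoid α] {P S : Type*} [Fintype P] [Fintype S] (n : ℕ)
    (g : (Fin n → P × S) → α) : ∑ Y, g Y = ∑ σ : Fin n → S, ∑ x : Fin n → P, g (fun i => (x i, σ i)) := by
  rw [← (Equiv.arrowProdEquivProdArrow (Fin n) (fun _ => P) (fun _ => S)).symm.sum_comp, Fintype.sum_prod_type, sum_comm]
  rfl

/-- **Prescribed-legs sizes across a plateau pair, split by a class of coarse label tuples** (BGM 2006 §2.8 (2.82)–(2.84),
(2.88)–(2.90), App. A3 Lemma A3.1: one overlap `L¹` norm per leg, the parents of the prescribed labels, the refinement count at fixed prescription — correlated through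
a class `B`).  For a thin/fat pair `F, F̃`, a family `F′` in the plateau of `F`, a relation `child` containing the support overlap, per-pair position
sums of `‖E(F′)S(F̃)‖` — fine position summed `≤ c₁`, coarse position summed `≤ c₁r` —, at most `ρ` coarse labels that are leg-wise parents (child
on the sector index, same spin and charge) of a fine label, a set `E` of legs, `p ∈ E`, a fine prescription `τ″`, refinement counts
`#{σ″ ∈ A″ : σ″|_E = τ″|_E, σ″ leg-wise child of σ′} ≤ R₁` for `σ′ ∉ B` and `≤ R₂` for `σ′ ∈ B`, and bounds `N₁` (all `σ′`) / `N₂` (`σ′ ∈ B`) on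
`ε_x^m Σ_{σ′ : σ′|_E = τ′|_E} Σ_{x′_p = y} ‖W_{F,σ′}(x′)‖` for all `τ′, y`: for every position `x`,
`ε_x^m Σ_{σ″ ∈ A″, σ″|_E = τ″|_E} Σ_{x″_p = x} ‖W_{F′,σ″}(x″)‖ ≤ c₁^m · c₁r · ρ^{|E|} · ε_x^m · (ε_x · (R₁ · N₁ + R₂ · N₂))`.
[cite: BenfattoGiulianiMastropietro2006, §2.8 (2.82)-(2.84) and (2.88)-(2.90), App. A3 Lemma A3.1] -/
theorem hubbardSectorPrescribedSum_refine_le_split_of_plateau_pair {β : ℝ} (hβ : 0 < β) (F Ft : Fin N → FreqMomentum L M → ℂ)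
    (hFF : ∀ ω k, Ft ω k * F ω k = F ω k) (hF0 : ∀ k, ∑ ω, F ω k = 0 → ∀ ω, F ω k = 0) (F' : Fin N' → FreqMomentum L M → ℂ)
    (hF'pl : ∀ (ω' : Fin N') (k : FreqMomentum L M), F' ω' k ≠ 0 → ∑ ω, F ω k = 1) (G : HubbardGrassmann L M)
    (child : Fin N' → Fin N → Prop) [DecidableRel child]
    (hchild : ∀ ω'' ω', ¬ child ω'' ω' → ∀ k, F' ω'' k * Ft ω' k = 0)
    {c₁ c₁r ρc R₁ R₂ N₁ N₂ : ℝ} (hc₁0 : 0 ≤ c₁) (hc₁r0 : 0 ≤ c₁r) (hR₁ : 0 ≤ R₁) (hR₂ : 0 ≤ R₂) (hN₁0 : 0 ≤ N₁) (hN₂0 : 0 ≤ N₂)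
    (hcol₁ : ∀ (ℓ'' : SectorLeg N') (X' : SpaceTimeIdx L M × SectorLeg N),
      ∑ x'' : SpaceTimeIdx L M, ‖(sectorAnalysisMatrix L M β F' * sectorSubMatrix L M β Ft) (x'', ℓ'') X'‖ ≤ c₁)
    (hrow₁ : ∀ (X'' : SpaceTimeIdx L M × SectorLeg N') (ℓ' : SectorLeg N),
      ∑ x' : SpaceTimeIdx L M, ‖(sectorAnalysisMatrix L M β F' * sectorSubMatrix L M β Ft) X'' (x', ℓ')‖ ≤ c₁r)
    (hρ : ∀ ℓ'' : SectorLeg N',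
      (((univ.filter fun ℓ' : SectorLeg N => child ℓ''.1.1 ℓ'.1.1 ∧ ℓ'.1.2 = ℓ''.1.2 ∧ ℓ'.2 = ℓ''.2).card : ℝ)) ≤ ρc)
    (m : ℕ) (A'' : Finset (Fin (m + 1) → SectorLeg N')) (B : Finset (Fin (m + 1) → SectorLeg N))
    (E : Finset (Fin (m + 1))) (τ'' : Fin (m + 1) → SectorLeg N') (p : Fin (m + 1)) (hp : p ∈ E)
    (hRoff : ∀ σ' : Fin (m + 1) → SectorLeg N, σ' ∉ B →
      (((A''.filter fun σ'' => (∀ e ∈ E, σ'' e = τ'' e) ∧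
          ∀ i, child (σ'' i).1.1 (σ' i).1.1 ∧ (σ' i).1.2 = (σ'' i).1.2 ∧ (σ' i).2 = (σ'' i).2).card : ℝ)) ≤ R₁)
    (hRon : ∀ σ' : Fin (m + 1) → SectorLeg N, σ' ∈ B →
      (((A''.filter fun σ'' => (∀ e ∈ E, σ'' e = τ'' e) ∧
          ∀ i, child (σ'' i).1.1 (σ' i).1.1 ∧ (σ' i).1.2 = (σ'' i).1.2 ∧ (σ' i).2 = (σ'' i).2).card : ℝ)) ≤ R₂)
    (hN₁ : ∀ (τ' : Fin (m + 1) → SectorLeg N) (y : SpaceTimeIdx L M),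
      imagTimeWeight β M ^ m * ∑ σ' ∈ univ.filter (fun σ' : Fin (m + 1) → SectorLeg N => ∀ e ∈ E, σ' e = τ' e),
        ∑ x' ∈ univ.filter (fun x' : Fin (m + 1) → SpaceTimeIdx L M => x' p = y),
          ‖sectorisedKernel L M β F G (m + 1) σ' x'‖ ≤ N₁)
    (hN₂ : ∀ (τ' : Fin (m + 1) → SectorLeg N) (y : SpaceTimeIdx L M),
      imagTimeWeight β M ^ m * ∑ σ' ∈ B.filter (fun σ' : Fin (m + 1) → SectorLeg N => ∀ e ∈ E, σ' e = τ' e),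
        ∑ x' ∈ univ.filter (fun x' : Fin (m + 1) → SpaceTimeIdx L M => x' p = y),
          ‖sectorisedKernel L M β F G (m + 1) σ' x'‖ ≤ N₂)
    (x : SpaceTimeIdx L M) :
    imagTimeWeight β M ^ m * ∑ σ'' ∈ A''.filter (fun σ'' => ∀ e ∈ E, σ'' e = τ'' e),
        ∑ x'' ∈ univ.filter (fun x'' : Fin (m + 1) → SpaceTimeIdx L M => x'' p = x),
          ‖sectorisedKernel L M β F' G (m + 1) σ'' x''‖ ≤
      c₁ ^ m * c₁r * ρc ^ E.card * imagTimeWeight β M ^ m * (imagTimeWeight β M * (R₁ * N₁ + R₂ * N₂)) := by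
  have hε : 0 ≤ imagTimeWeight β M := imagTimeWeight_nonneg hβ.le M
  set T : SpaceTimeIdx L M × SectorLeg N' → SpaceTimeIdx L M × SectorLeg N → ℂ :=
    fun X'' X' => (sectorAnalysisMatrix L M β F' * sectorSubMatrix L M β Ft) X'' X' with hT
  set W : (Fin (m + 1) → SectorLeg N) → (Fin (m + 1) → SpaceTimeIdx L M) → ℂ :=
    (((imagTimeWeight β M : ℝ) : ℂ) ^ (m + 1)) • sectorisedKernel L M β F G (m + 1) with hW
  -- the fine sectorised kernels are the leg-wise transform of `ε^{m+1} ·` the coarse ones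
  have hker : ∀ (σ'' : Fin (m + 1) → SectorLeg N') (x'' : Fin (m + 1) → SpaceTimeIdx L M),
      sectorisedKernel L M β F' G (m + 1) σ'' x'' =
      ∑ σ' : Fin (m + 1) → SectorLeg N, ∑ x' : Fin (m + 1) → SpaceTimeIdx L M, (∏ i, T (x'' i, σ'' i) (x' i, σ' i)) * W σ' x' := by
    intro σ'' x''
    have h1 : kernel ℂ (ExteriorAlgebra.map (Matrix.toLin' (sectorAnalysisMatrix L M β F')) G) (m + 1) (fun i => (x'' i, σ'' i)) =
        sectorisedKernel L M β F' G (m + 1) σ'' x'' := by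
      simpa only using kernel_map_sectorAnalysis β F' G (m + 1) (fun i => (x'' i, σ'' i))
    rw [← h1, map_sectorAnalysis_eq_map_comp_sectorPreimage_of_plateau hβ.ne' F Ft hFF hF0 F' hF'pl G, kernel_map,
      LinearMap.toMatrix'_comp, LinearMap.toMatrix'_toLin', LinearMap.toMatrix'_toLin',
      sum_tuple_prod_eq_sum_sum' (m + 1) (fun Y' : Fin (m + 1) → SpaceTimeIdx L M × SectorLeg N =>
        (∏ i, T (x'' i, σ'' i) (Y' i)) * kernel ℂ (sectorPreimage β F G) (m + 1) Y')]
    refine sum_congr rfl fun σ' _ => sum_congr rfl fun x' _ => ?_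
    congr 1
    simpa only [hW, Pi.smul_apply, smul_eq_mul] using kernel_sectorPreimage_eq_sectorisedKernel β F G (m + 1) (fun i => (x' i, σ' i))
  -- the prescribed sums of `ε^{m+1} · W_F` are `ε^{m+1} ·` those of `W_F`
  have hnW : ∀ σ' x', ‖W σ' x'‖ = imagTimeWeight β M ^ (m + 1) * ‖sectorisedKernel L M β F G (m + 1) σ' x'‖ := by
    intro σ' x'
    rw [hW, Pi.smul_apply, Pi.smul_apply, smul_eq_mul, norm_mul, norm_pow, Complex.norm_real, Real.norm_of_nonneg hε]
  have hNW : ∀ (Bs : Finset (Fin (m + 1) → SectorLeg N)) (Nb : ℝ),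
      (∀ (τ' : Fin (m + 1) → SectorLeg N) (y : SpaceTimeIdx L M),
        imagTimeWeight β M ^ m * ∑ σ' ∈ Bs.filter (fun σ' : Fin (m + 1) → SectorLeg N => ∀ e ∈ E, σ' e = τ' e),
          ∑ x' ∈ univ.filter (fun x' : Fin (m + 1) → SpaceTimeIdx L M => x' p = y),
            ‖sectorisedKernel L M β F G (m + 1) σ' x'‖ ≤ Nb) →
      ∀ (τ' : Fin (m + 1) → SectorLeg N) (y : SpaceTimeIdx L M),
        imagTimeWeight β M ^ m * ∑ σ' ∈ Bs.filter (fun σ' : Fin (m + 1) → SectorLeg N => ∀ e ∈ E, σ' e = τ' e),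
          ∑ x' ∈ univ.filter (fun x' : Fin (m + 1) → SpaceTimeIdx L M => x' p = y), ‖W σ' x'‖ ≤
          imagTimeWeight β M ^ (m + 1) * Nb := by
    intro Bs Nb hNb τ' y
    simp_rw [hnW]
    rw [← sum_congr rfl fun σ' _ => mul_sum _ _ _, ← mul_sum, mul_left_comm]
    exact mul_le_mul_of_nonneg_left (hNb τ' y) (pow_nonneg hε _)
  have hmain := prescribedLegSum_refine_le_split (𝕜 := ℂ) hε T
    (fun (ℓ'' : SectorLeg N') (ℓ' : SectorLeg N) => child ℓ''.1.1 ℓ'.1.1 ∧ ℓ'.1.2 = ℓ''.1.2 ∧ ℓ'.2 = ℓ''.2)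
    (fun x'' ℓ'' x' ℓ' h => sectorAnalysis_mul_sectorSub_eq_zero_of_not_child β F' Ft child hchild x'' ℓ'' x' ℓ' h)
    hc₁0 hc₁r0 hR₁ hR₂ (mul_nonneg (pow_nonneg hε _) hN₁0) (mul_nonneg (pow_nonneg hε _) hN₂0)
    (fun ℓ'' x' ℓ' => hcol₁ ℓ'' (x', ℓ')) (fun x'' ℓ'' ℓ' => hrow₁ (x'', ℓ'') ℓ') (fun ℓ'' => by convert hρ ℓ'' using 4)
    A'' B E τ'' p hp (fun σ' hσ' => by convert hRoff σ' hσ' using 4) (fun σ' hσ' => by convert hRon σ' hσ' using 4)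
    W (hNW univ N₁ hN₁) (hNW B N₂ hN₂) x
  calc imagTimeWeight β M ^ m * ∑ σ'' ∈ A''.filter (fun σ'' => ∀ e ∈ E, σ'' e = τ'' e),
        ∑ x'' ∈ univ.filter (fun x'' : Fin (m + 1) → SpaceTimeIdx L M => x'' p = x), ‖sectorisedKernel L M β F' G (m + 1) σ'' x''‖
      = imagTimeWeight β M ^ m * ∑ σ'' ∈ A''.filter (fun σ'' => ∀ e ∈ E, σ'' e = τ'' e),
          ∑ x'' ∈ univ.filter (fun x'' : Fin (m + 1) → SpaceTimeIdx L M => x'' p = x),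
            ‖∑ σ' : Fin (m + 1) → SectorLeg N, ∑ x' : Fin (m + 1) → SpaceTimeIdx L M,
              (∏ i, T (x'' i, σ'' i) (x' i, σ' i)) * W σ' x'‖ := by
        refine congrArg _ (sum_congr rfl fun σ'' _ => sum_congr rfl fun x'' _ => ?_)
        rw [hker σ'' x'']
    _ ≤ c₁ ^ m * c₁r * ρc ^ E.card * (R₁ * (imagTimeWeight β M ^ (m + 1) * N₁) + R₂ * (imagTimeWeight β M ^ (m + 1) * N₂)) := hmain
    _ = c₁ ^ m * c₁r * ρc ^ E.card * imagTimeWeight β M ^ m * (imagTimeWeight β M * (R₁ * N₁ + R₂ * N₂)) := by ring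

end Literature.MathematicalPhysics.QuantumLattice

end
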